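import Mathlib
import Literature.MathematicalPhysics.QuantumFieldTheory.MagnenRivasseauSeneor1993.MRS93CountertermScaling
import Literature.MathematicalPhysics.QuantumFieldTheory.MagnenRivasseauSeneor1993.MRS93AppendixA5Constants
import Literature.MathematicalPhysics.QuantumFieldTheory.MagnenRivasseauSeneor1993.MRS93HomotheticLemmaVI2
import HarnessLib

/-!
# Magnen–Rivasseau–Sénéor, *Construction of YM₄ with an infrared cutoff* (CMP 155, 1993), Lemma III.1 (p.348) — the positivity
# clause «by choosing the cutoff of the form (II.14) with η small enough … the coefficient a is strictly positive» AT ONE LOOP: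
# the three-region decomposition (III.5) and the «finite terms» of (III.6) PROVED BOUNDED for the actual cutoff (II.14), so that
# the AS-PRINTED predicate `Counterterms.LemmaIII1PositivityPrinted` HOLDS for the printed one-loop integral (III.4)

elementary real analysis (a piecewise-defined cutoff integrated against `dr/r`, polar coordinates in `ℝ⁴`, the scale invariance of
`d⁴p/p⁴`); nothing here is a claim about the Yang–Mills mass gap, about continuum YM₄ on `T⁴` (with or without infrared cutoff), or
about the Clay problem — and nothing about the Feynman rules, the dominance of the one-loop term, or the scaling (III.2) is asserted

**Citation header (reproduction of PUBLISHED work).** J. Magnen, V. Rivasseau, R. Sénéor, *Construction of YM₄ with an infrared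
cutoff*, Commun. Math. Phys. **155** (1993) 325–383 [MagnenRivasseauSeneor1993], Sect. III «The Effect of the Ultraviolet Cutoff:
Computation of the Gauge Restoring Counterterms», Lemma III.1 p.348 [PDF 24] and (III.4)–(III.7) pp.351–352 [PDF 27–28]; (II.13)–(II.14)
p.331. Loci «p.NNN [PDF nn] tl.k» = journal page, PDF page (= journal page − 324), text-layer line of the held scan
`paper:magnen1993-cmp155-mrs-ym4-infrared-cutoff`; the displays (III.4)–(III.5) were read on the page render of record
`run/shared/lean/pub/lit-balaban/inprint/lit-balaban-p14/renders-cmp155/p27_full_s6.png` (the text layer garbles them), (III.6)–(III.7) on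
`p28_full_s6.png` (as quoted in the tree's `MRS93OneLoopCounterterms`). Cell pub-balaban-gaps (YM blitz, track G3 «MRS 1993 typed AS
PRINTED»), seat mrs-lit-2 (gen 19, file 53); companion record `run/shared/lean/pub/pub-balaban-gaps/g3/MRS-AS-PRINTED-estimates.md`. The
earlier printing of the same computation is [R] = Rivasseau, *From Perturbative to Constructive Renormalization* (1991) §III.5.C,
Lemma III.5.1 pp.262–263 (census §8 E6; «We obtain:»).

**Imports, nothing restated.** mrs-lit-1's statement layer `MRS93StartingAnsatz` (`Ansatz.CutoffProfile` = the reference function τ of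
p.330, `Ansatz.cutoffFn P η` = κ of (II.14) as a function of `r = |p|`, `Ansatz.scaledCutoff` = κ_ρ of (II.13), with the region lemmas
`cutoffFn_of_le_one` ∕ `cutoffFn_plateau` ∕ `cutoffFn_eq_zero_of_le`, `cutoffFn_nonneg` ∕ `cutoffFn_le_one` ∕ `cutoffFn_antitone`) via this
seat's `MRS93AppendixA5Constants`; the tree's `MRS93OneLoopCounterterms` (lit-balaban lineage: the printed graph totals `OneLoop.G1 … G4`,
`one_loop_A4_sum_eq_zero`, the plateau mechanism `plateauWeight` ∕ `log_plateau_eq` ∕ `abs_log_plateau_remainder_le`, `lnEtaCoeff` and the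
sign analysis `stabilizing_coefficient_ge_half_log` ∕ `…_large`) and this seat's file 3 `MRS93CountertermScaling` (the AS-PRINTED predicate
`Counterterms.LemmaIII1PositivityPrinted aOf := ∃ η₀ > 0, ∀ η ∈ (0, η₀], 0 < aOf η`, the shape `oneLoopA4Coeff t F η = lnEtaCoeff(t)·(−log η)
+ F(η)` and the bridge `positivity_of_boundedFiniteTerms`: bounded finite terms ⟹ the predicate). What the tree had NOT: the two
transition regions of (II.14) («the interpolating shape τ of (II.14) and the regions |p| ≤ 2, |p| ≥ 2 + η⁻¹ (they produce the «finite
terms»)» — `MRS93OneLoopCounterterms`, «What is NOT claimed»; file 3 takes `|F| ≤ C` as a HYPOTHESIS). This file supplies exactly that.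

**What the paper prints (verbatim, from the page renders).**
* Lemma III.1, p.348 [PDF 24] tl.5–8: *«Lemma III.1. a_ρ ≅ aλ_ρ⁴, b_ρ ≅ bM^{2ρ}λ_ρ², c_ρ ≅ cλ_ρ², d_ρ ≅ dλ_ρ², e_ρ ≅ eλ_ρ⁴. (III.2)
  Furthermore by choosing the cutoff of the form (II.14) with η small enough (depending on the shape of τ), the coefficient a is strictly
  positive⁵.»*
* p.351 [PDF 27] tl.8–9: *«As a consequence of our expansion the leading contribution is the one-loop contribution; we want its sign to be
  positive.»*; tl.14–19: *«Let κ(p) be the ultraviolet cutoff function in momentum space. … Remark that since there is one cutoff per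
  propagator the cutoff acts differently G₁, G₂, G₃ and G₄. More precisely using the coefficients computed in the preceding section, the
  one loop contribution to the (A⁴/24) term is, for a single cutoff κ_ρ(p) = κ(pM^{−ρ}) (all our integrals are infrared regularized and
  "finite" means finite as ρ → ∞):»* **(III.4)**: *«∫ (d⁴p/p⁴) [(36 + 18(1/ζ − 1) + 7.5(1/ζ − 1)²)κ²(pM^{−ρ}) − (90 + 45(1/ζ − 1) +
  15(1/ζ − 1)²)κ³(pM^{−ρ}) + (54 + 27(1/ζ − 1) + 7.5(1/ζ − 1)²)κ⁴(pM^{−ρ})] = 0 · ρ + finite terms, (III.4) where the finite terms are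
  finite functions of the particular shape of κ and are therefore difficult to compute in the general case.»* [parentheses sic: the print
  has «− (90 + 45)1/ζ − 1) + 15(1/ζ − 1)²)κ³» and «+ (54 + 27)1/ζ − 1) + 7.5(1/ζ − 1)²)κ⁴» in (III.4) (p.351 tl.20–21) and again in the
  first two integrals of (III.5) — two misplaced parentheses each, normalised in these quotes to the grouping the third integral of (III.5)
  and (III.6) print correctly; EDITION v1.2 records the normalisation, referee GEN 59 nit (n2)] *« However we are going to use
  a shape such as (II.14) in which there is a free parameter η that we can vary, and we will study the finite terms in the limit η → 0. In
  this case it is easy to analyze the asymptotic behavior of the finite terms in (III.4)»*.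
* **(III.5)** p.351: *«For κ_ρ defined as in (II.13–14), the corresponding contribution is indeed: ∫_{1≤|p|M^{−ρ}<2} (d⁴p/p⁴)[(36 + …)κ²
  (pM^{−ρ}) − (90 + …)κ³(pM^{−ρ}) + (54 + …)κ⁴(pM^{−ρ})] + ∫_{2+η⁻¹<|p|M^{−ρ}≤3+η⁻¹} (d⁴p/p⁴)[ … the same bracket … ]
  + ∫_{2≤|p|M^{−ρ}<2+η⁻¹} (d⁴p/p⁴)[(36 + 18(1/ζ − 1) + 7.5(1/ζ − 1)²)/4 − (90 + 45(1/ζ − 1) + 15(1/ζ − 1)²)/8 + (54 + 27(1/ζ − 1) +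
  7.5(1/ζ − 1)²)/16]. (III.5)»* — the transition shell, the tail shell and the plateau (where `κ = 1/2`).
* **(III.6)** p.352 [PDF 28] tl.2–9: *«As a consequence the one loop (A²/24) [sic — printed «A²»; the term is the quartic one, «(A⁴/24)»
  at p.351 tl.17 and in (III.7); EDITION v1.2, referee GEN 59 nit (n1)] contribution behaves as [(36 + …)/4 − (90 + …)/8 + (54 +
  …)/16](−ln η) + finite terms = 9/8(1 + (1/ζ − 1)/2 + 5/12(1/ζ − 1)²)|ln η| + finite terms, (III.6) where "finite terms" now means terms
  which are uniformly bounded both as ρ tends to +∞ and η tends to 0.»* (the right-hand side is printed with two dropped symbols, read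
  through the three brackets as in `MRS93OneLoopCounterterms`); tl.9–15 + **(III.7)**: *«The polynomial … is always positive and greater
  than 17/20. Since (17/20)·(9/8) ≥ 1/2, taking η small enough (depending on the details of our cutoff, which are responsible for the
  particular value of the finite terms) we can always achieve our goal of a positive total A⁴ contribution, hence of a negative stabilizing
  counterterm, with value at least e^{−(1/2)∫_Λ(A⁴/24)|ln η|}. (III.7)»*; tl.16–17: *«Remark that the coefficient of this stabilizing term
  can be made as large as we want, if η is small enough.»*
* (II.14) p.331 [PDF 7]: *«κ(p) ≡ 1 if |p| ≤ 1, κ(p) ≡ (1 + τ(|p|))/2 if 1 < |p| ≤ 2, κ(p) ≡ 1/2 if 2 < |p| ≤ 2 + η⁻¹, κ(p) ≡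
  (1/2)τ(|p| − 1 − η⁻¹) if 2 + η⁻¹ < |p|, (II.14) where η is a small constant.»* (τ: «we take a one variable C₀^∞ function, monotone decreasing,
  which is 0 for x > 2 and is 1 for x < 1», p.330 tl.33–34) and (II.13) *«κ_ρ(p) = κ(pM^{−ρ})»*.

**What is formalised (every statement below is a `theorem` with its proof; `P : CutoffProfile` = ANY profile τ of the printed class,
`η > 0` the width parameter, `t = 1/ζ − 1` ANY real).**
* §1 `bracket t κ = G₁κ² + G₂κ³ + (G₃ + G₄)κ⁴` (the integrand of (III.4) as a polynomial in the cutoff value; `bracket_eq_printed` with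
  the printed numbers `36 + 18t + 7.5t²`, `−(90 + 45t + 15t²)`, `54 + 27t + 7.5t²`); **`bracket_one`** `= 0` (the printed «0 · ρ»: where
  `κ = 1`, i.e. `|p| ≤ M^ρ`, the integrand vanishes — no logarithmic divergence, no infrared singularity at `p = 0`), `bracket_zero`,
  **`bracket_half`** `= lnEtaCoeff t = 9/8(1 + t/2 + 5t²/12)` (the plateau value IS the `|ln η|`-coefficient of (III.6)), and the
  τ-independent bound `abs_bracket_le`: `|bracket t κ| ≤ absCoeff t := |G₁| + |G₂| + |G₃ + G₄|` on `0 ≤ κ ≤ 1`.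
* §2 `radialIntegrand P η t r = bracket(κ(r))/r` (`d⁴p/p⁴ = |S³| dr/r`), vanishing for `r ≤ 1` and for `r ≥ 3 + η⁻¹`
  (`radialIntegrand_of_le_one`, `radialIntegrand_of_le`), `= lnEtaCoeff/r` on the plateau; measurable (κ is monotone) and
  interval-integrable on every `[a, b] ⊂ (0, ∞)`; **`oneLoopA4Radial P η t := ∫_1^{3+η⁻¹} bracket(κ(r)) dr/r`** — the one-loop (A⁴/24)
  coefficient of (III.4) for the cutoff (II.14), radial form, integrated over the support of its integrand.
* §3 **(III.5)**: `abs_integral_shell_le` (a shell `[a, b]` costs at most `absCoeff·log(b/a)`), **`abs_integral_core_le`** (the transition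
  shell `[1, 2]`: `≤ absCoeff(t)·log 2`, uniformly in η AND in τ), **`integral_plateau_eq`** (the plateau: EXACTLY
  `lnEtaCoeff(t)·log((2 + η⁻¹)/2)`), **`abs_integral_tail_le`** (the tail `[2 + η⁻¹, 3 + η⁻¹]`: `≤ absCoeff(t)·log 2`), and the
  decomposition itself **`oneLoopA4Radial_split`** (= the three printed region integrals of (III.5), in radial form).
* §4 **(III.6) with the finite terms PROVED bounded**: `finiteTerms P t η := oneLoopA4Radial − lnEtaCoeff(t)·(−log η)` obeys
  **`abs_finiteTerms_le`**: `|finiteTerms| ≤ finiteConst t := (lnEtaCoeff t + 2·absCoeff t)·log 2` for every `0 < η ≤ ½` — EXPLICIT and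
  UNIFORM IN THE PROFILE τ; `oneLoopA4Radial_eq_oneLoopA4Coeff` (the coefficient has file 3's shape `oneLoopA4Coeff t (finiteTerms P t)`);
  hence **`lemmaIII1Positivity_oneLoopA4Radial : Counterterms.LemmaIII1PositivityPrinted (fun η ↦ oneLoopA4Radial P η t)`** — Lemma
  III.1's positivity clause DISCHARGED for the printed one-loop integral, every τ, every gauge (`η₀ = min(½, ½, exp(−160·finiteConst(t)/73))`
  from file 3's bridge); and (III.7) quantitatively: **`half_abs_log_le_oneLoopA4Radial`** (`a(η) ≥ ½|ln η|` for
  `η ≤ min(½, exp(−160·finiteConst(t)/73))`), `oneLoopA4Radial_pos`, `le_oneLoopA4Radial_of_small` («as large as we want»); and (III.6) as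
  the printed ASYMPTOTIC statement **`tendsto_oneLoopA4Radial_div_log`**: `a(η)/|ln η| → 9/8(1 + t/2 + 5t²/12)` as `η → 0⁺`;
  worked numbers at `ζ = 1`: `finiteConst_feynman` (`absCoeff 0 = 180`, `finiteConst 0 = (9/8 + 360)·log 2`); and the SHAPE in which
  Sect. VI uses (III.7) at (VI.35) — `abs_log_le_two_mul_oneLoopA4Radial`: `|ln η| ≤ 2a(η)` below the threshold (the hypothesis
  `|Real.log η| ≤ CT₄` of this seat's `MRS93HomotheticLemmaVI2.lemmaVI1Printed_cross_of_representation`, for `CT₄ = 2a(η)`).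
* §5 `d = 4` AS PRINTED: **`oneLoopA4Integral P η t := ∫_{ℝ⁴} bracket(κ(|p|))/|p|⁴ d⁴p`** ((III.4) for the cutoff (II.14));
  **`oneLoopA4Integral_eq`**: `= 2π²·oneLoopA4Radial` (polar coordinates, Mathlib's `integral_fun_norm_addHaar`, `|S³| = 4·vol(B⁴) = 2π²`;
  the integrand vanishes off `1 ≤ |p| ≤ 3 + η⁻¹`); **(III.5) in `d = 4` AS PRINTED**: the shell integrals `regionIntegral P η t a b :=
  ∫_{a<|p|≤b} bracket(κ(|p|))/|p|⁴ d⁴p` (`regionIntegral_eq`: `= 2π²∫_a^b bracket(κ(r))dr/r`), **`displayIII5`**: `oneLoopA4Integral =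
  region[1,2] + region[2+η⁻¹, 3+η⁻¹] + region[2, 2+η⁻¹]` in the printed order, **`regionIntegral_plateau_eq`** (the plateau region `=
  2π²·9/8(1 + t/2 + 5t²/12)·log((2 + η⁻¹)/2)`, the tree's `OneLoop.one_loop_A4_shell_eq` value) and `abs_regionIntegral_transition_le`
  (each transition region `≤ 2π²·absCoeff·log 2`); **`lemmaIII1Positivity_oneLoopA4Integral`** (the predicate for the `d = 4` integral);
  **`oneLoopA4Integral_scale`** ∕ **`oneLoopA4Integral_scaledCutoff`**: replacing `κ(|p|)` by `κ_ρ(|p|) = κ(|p|M^{−ρ})` ((II.13), mrs-lit-1's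
  `Ansatz.scaledCutoff`, any `M > 0`, any `ρ`; indeed any dilation `κ(c|p|)`, `c > 0`) leaves the integral UNCHANGED — `d⁴p/p⁴` is scale
  invariant, which is the content of «"finite" means finite as ρ → ∞» for this integral: it does not depend on ρ at all; hence
  `lemmaIII1Positivity_scaledCutoff`: the predicate for the integral written with `κ_ρ`, every `ρ`, same threshold.
* §6 (v1.1) **`lemmaVI1Printed_cross_of_representation_oneLoopCT`** ∕ `…_cross_homothetic_…`: Lemma VI.1 (VI.5) from (VI.14) alone
  when its quartic-counterterm term is `N·oneLoopA4Radial` (`N > 0` arbitrary), via file 21's `dressingFactor_le_one_crossReg_uniform`.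

**EDITION v1.1 (same seat, gen 19; append-only — every v1 declaration byte-identical; one import added:
`MRS93HomotheticLemmaVI2`, this seat's file 21).** §6 SECT. VI CONSUMES (III.7): file 21 proved (VI.35) ⟹ Lemma VI.1 (VI.5) for the
cross-ordered homothetic integrand with Lemma VI.2 discharged and two NAMED inputs, the representation (VI.14) and «(III.7)» as
`|log η| ≤ CT₄`. **`lemmaVI1Printed_cross_of_representation_oneLoopCT`** removes the second: if the representation's quartic-counterterm
term is `CT₄ = N · oneLoopA4Radial P η (1/ζ − 1)` for ANY fixed `N > 0` (the (VI.14) third bracket IS a positive multiple of Sect. III's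
one-loop integral; the multiple is left as a parameter, its printed value not asserted), then `Stability.LemmaVI1Printed D` follows from
(VI.14) ALONE, with the explicit threshold `min(η₁/2, ½, exp(−(K₁K₂/N + finiteConst)·160/153))` — because `a(η) ≥ K₁K₂/N` for small `η`
(§4, «as large as we want»), so the printed detour «CT₄ ≥ |log η| ≥ K₁K₂» is replaced by `CT₄ ≥ K₁K₂` directly and NO normalisation
condition on `N` arises; `…_cross_homothetic_…` is the instance `ζ = 3/13`. So, for the cross ordering, of Sect. VI's printed chain ONLY
the representation (VI.14) remains a named input (census §4).

**EDITION v1.2 (same seat, gen 20; DOCSTRINGS ONLY — every declaration of v1.1 byte-identical, no import change).** Quote-fidelity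
fixes logged by the cell referee (GEN 59, R8 on this file): (n1) the (III.6) sentence p.352 tl.2 prints «(A²/24)» — now quoted with
[sic] (it is the quartic term, «(A⁴/24)» at p.351 tl.17 and in (III.7)); (n2) the two misplaced closing parentheses of (III.4) ∕ (III.5)
(«(90 + 45)1/ζ − 1)», «(54 + 27)1/ζ − 1)») are now recorded next to the normalised quote; (n3) text-layer locators of p.352 corrected
(the running head is text-layer line 1): «where "finite terms" now means …» = tl.8–9, «The polynomial … (III.7)» = tl.9–15, «Remark that
the coefficient …» = tl.16–17. Nothing else moves.

**Readings (declared).** (i) The four graph totals `36 + 18t + 7.5t²`, … are TYPED INPUTS exactly as in `MRS93OneLoopCounterterms`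
(reading (i) there): the Feynman rules of Fig. III.1 and the tensor contractions of pp.348–350 are not formalised; what is integrated
is the printed bracket of (III.4). (ii) «the one loop contribution to the (A⁴/24) term» is typed as the displayed integral (III.4) itself,
up to the overall constants the paper also drops («we always forget to write the overall multiplication factor (of 2π) …», p.348 tl.16–18);
in particular `oneLoopA4Radial` is (III.4) divided by `|S³| = 2π²` (`oneLoopA4Integral_eq`), the normalisation in which (III.6) reads
`9/8(…)|ln η| + finite` — positivity and the threshold are insensitive to this positive factor (`lemmaIII1Positivity_oneLoopA4Integral`).
(iii) «η small enough (depending on the shape of τ)»: our bound on the finite terms uses only `0 ≤ κ ≤ 1` on the two transition shells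
and their η-independent logarithmic lengths `log 2`, `log((3 + η⁻¹)/(2 + η⁻¹)) ≤ log 2`, so the threshold obtained is UNIFORM in τ — a
cruder-but-uniform account of the printed dependence; the exact finite terms do depend on τ (`integral` of `(1 + τ)/2`-powers over
`[1, 2]`, cf. `MRS93AppendixA5Constants.A5_core_integral_eq`). (iv) `|ln η| = −log η` (`0 < η ≤ ½`). (v) (III.5)'s half-open ∕ closed
region boundaries are immaterial (Lebesgue-null spheres); the shells are typed as the interval integrals `∫_1^2`, `∫_2^{2+η⁻¹}`,
`∫_{2+η⁻¹}^{3+η⁻¹}` of the radial form. (vi) `λ`, `κ` are not Lean identifiers here: the cutoff value is the real variable `κ` of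
`bracket`, the cutoff function is `cutoffFn P η`.

**What is NOT claimed.** That the one-loop term is «the leading contribution» of MRS's expansion (p.351 tl.8–9 — the expansion's claim,
Sects. V–VII); the graph totals from the Feynman rules; (III.2) (the scaling `a_ρ ≅ aλ_ρ⁴`, … — file 3's OTHER predicate
`LemmaIII1ScalingPrinted`, untouched); the A² ∕ A(−Δ)A ∕ (∂A)² ∕ F₄ counterterms; (III.7) as a statement about the functional integral
(`e^{−(1/2)∫_Λ(A⁴/24)|ln η|}` is the USE of the positive coefficient in Sect. VI's (VI.35), typed in `MRS93StabilityEstimate`); anything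
of Sects. IV–VIII; anything of Bałaban's papers. MRS work at FIXED INFRARED CUTOFF on a finite volume: nothing here bears on infinite
volume, on the continuum limit of YM₄ on `T⁴` as a whole, or on a mass gap.
-/

noncomputable section

open Real MeasureTheory MeasureTheory.Measure Set Metric intervalIntegral

namespace Literature.MathematicalPhysics.QuantumFieldTheory.MagnenRivasseauSeneor1993

namespace OneLoopFiniteTerms

open Ansatz OneLoop Counterterms

variable (P : CutoffProfile) {η : ℝ} (t : ℝ)

/-! ## §1 The printed integrand of (III.4) as a polynomial in the cutoff value -/

/-- The bracket of (III.4) p.351 as a polynomial in the value `κ` of the cutoff: graph `G₁` (two propagators) carries `κ²`,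
`G₂` (three) `κ³`, `G₃`, `G₄` (four) `κ⁴`, with the printed graph totals of the tree's `OneLoop.G1 … G4`
(`36 + 18t + 7.5t²`, `−(90 + 45t + 15t²)`, `55.5 + 27t + 7.5t²`, `−1.5`; `t = 1/ζ − 1`).
[cite: MagnenRivasseauSeneor1993, (III.4) p.351] -/
def bracket (t κ : ℝ) : ℝ := G1 t * κ ^ 2 + G2 t * κ ^ 3 + (G3 t + G4) * κ ^ 4

/-- The bracket with the printed numbers. [cite: MagnenRivasseauSeneor1993, (III.4) p.351] -/
theorem bracket_eq_printed (t κ : ℝ) :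
    bracket t κ = (36 + 18 * t + 7.5 * t ^ 2) * κ ^ 2 - (90 + 45 * t + 15 * t ^ 2) * κ ^ 3
      + (54 + 27 * t + 7.5 * t ^ 2) * κ ^ 4 := by
  unfold bracket G1 G2 G3 G4
  ring

/-- Where the cutoff equals `1` (i.e. `|p| ≤ M^ρ`) the integrand VANISHES: `G₁ + G₂ + G₃ + G₄ = 0` — the printed «`= 0·(…) + finite
terms`» of (III.4) (no logarithmic divergence; the tree's `OneLoop.one_loop_A4_sum_eq_zero`).
[cite: MagnenRivasseauSeneor1993, (III.4) p.351] -/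
theorem bracket_one : bracket t 1 = 0 := by
  have h := one_loop_A4_sum_eq_zero t
  unfold bracket
  linarith

/-- Where the cutoff vanishes so does the integrand. [cite: MagnenRivasseauSeneor1993, (III.4) p.351] -/
theorem bracket_zero : bracket t 0 = 0 := by
  unfold bracket
  ring

/-- On the plateau `κ = 1/2` the bracket IS the `|ln η|`-coefficient of (III.6): `bracket(1/2) = lnEtaCoeff t = 9/8(1 + t/2 + 5t²/12)`.
[cite: MagnenRivasseauSeneor1993, (III.6) p.352] -/
theorem bracket_half : bracket t (1 / 2) = lnEtaCoeff t := by
  unfold bracket lnEtaCoeff plateauWeight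
  ring

/-- The sum of the absolute graph totals, a τ-INDEPENDENT bound for the bracket on `0 ≤ κ ≤ 1`.
[cite: MagnenRivasseauSeneor1993, (III.4) p.351] -/
def absCoeff (t : ℝ) : ℝ := |G1 t| + |G2 t| + |G3 t + G4|

/-- `absCoeff t ≥ 0`. [cite: MagnenRivasseauSeneor1993, (III.4) p.351] -/
theorem absCoeff_nonneg : 0 ≤ absCoeff t := by
  unfold absCoeff
  positivity

/-- `|bracket t κ| ≤ |G₁| + |G₂| + |G₃ + G₄|` for `0 ≤ κ ≤ 1`. [cite: MagnenRivasseauSeneor1993, (III.4) p.351] -/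
theorem abs_bracket_le {κ : ℝ} (h0 : 0 ≤ κ) (h1 : κ ≤ 1) : |bracket t κ| ≤ absCoeff t := by
  have hk2 : κ ^ 2 ≤ 1 := pow_le_one₀ h0 h1
  have hk3 : κ ^ 3 ≤ 1 := pow_le_one₀ h0 h1
  have hk4 : κ ^ 4 ≤ 1 := pow_le_one₀ h0 h1
  unfold bracket absCoeff
  calc |G1 t * κ ^ 2 + G2 t * κ ^ 3 + (G3 t + G4) * κ ^ 4|
      ≤ |G1 t * κ ^ 2| + |G2 t * κ ^ 3| + |(G3 t + G4) * κ ^ 4| := abs_add_three _ _ _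
    _ = |G1 t| * κ ^ 2 + |G2 t| * κ ^ 3 + |G3 t + G4| * κ ^ 4 := by
        rw [abs_mul, abs_mul, abs_mul, abs_of_nonneg (by positivity : (0:ℝ) ≤ κ ^ 2),
          abs_of_nonneg (by positivity : (0:ℝ) ≤ κ ^ 3), abs_of_nonneg (by positivity : (0:ℝ) ≤ κ ^ 4)]
    _ ≤ |G1 t| * 1 + |G2 t| * 1 + |G3 t + G4| * 1 := by
        gcongr
    _ = |G1 t| + |G2 t| + |G3 t + G4| := by ring

/-! ## §2 The radial one-loop integral for the cutoff (II.14) -/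

/-- The radial integrand of (III.4) for the cutoff `κ` of (II.14) (every profile `τ`, parameter `η`): `bracket(κ(r))/r`
(`d⁴p/p⁴ = |S³| r³dr/r⁴ = 2π² dr/r`). [cite: MagnenRivasseauSeneor1993, (II.14) p.331, (III.4) p.351] -/
def radialIntegrand (P : CutoffProfile) (η t r : ℝ) : ℝ := bracket t (cutoffFn P η r) / r

/-- The integrand vanishes for `r ≤ 1` (`κ = 1`). [cite: MagnenRivasseauSeneor1993, (II.14) p.331, (III.4) p.351] -/
theorem radialIntegrand_of_le_one {r : ℝ} (hr : r ≤ 1) : radialIntegrand P η t r = 0 := by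
  simp [radialIntegrand, cutoffFn_of_le_one P η hr, bracket_one]

/-- The integrand vanishes for `r ≥ 3 + η⁻¹` (`κ = 0`). [cite: MagnenRivasseauSeneor1993, (II.14) p.331, (III.4) p.351] -/
theorem radialIntegrand_of_le (hη : 0 < η) {r : ℝ} (hr : 3 + η⁻¹ ≤ r) : radialIntegrand P η t r = 0 := by
  simp [radialIntegrand, cutoffFn_eq_zero_of_le P η hη hr, bracket_zero]

/-- On the plateau the integrand is `lnEtaCoeff(t)/r`. [cite: MagnenRivasseauSeneor1993, (II.14) p.331, (III.6) p.352] -/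
theorem radialIntegrand_plateau {r : ℝ} (h2 : 2 < r) (h3 : r ≤ 2 + η⁻¹) :
    radialIntegrand P η t r = lnEtaCoeff t / r := by
  unfold radialIntegrand
  rw [cutoffFn_plateau P η h2 h3, bracket_half]

/-- Pointwise bound `|bracket(κ(r))/r| ≤ absCoeff(t)/a` for `r ≥ a > 0`. [cite: MagnenRivasseauSeneor1993, (III.4) p.351] -/
theorem abs_radialIntegrand_le {a r : ℝ} (ha : 0 < a) (har : a ≤ r) :
    |radialIntegrand P η t r| ≤ absCoeff t / a := by
  have hr : 0 < r := lt_of_lt_of_le ha har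
  unfold radialIntegrand
  rw [abs_div, abs_of_pos hr]
  have hb := abs_bracket_le t (cutoffFn_nonneg P η r) (cutoffFn_le_one P η r)
  calc |bracket t (cutoffFn P η r)| / r ≤ absCoeff t / r := by gcongr
    _ ≤ absCoeff t / a := by
        exact div_le_div_of_nonneg_left (absCoeff_nonneg t) ha har

/-- The cutoff (II.14) is measurable (it is monotone decreasing, `Ansatz.cutoffFn_antitone`).
[cite: MagnenRivasseauSeneor1993, (II.14) p.331] -/
theorem measurable_cutoffFn (hη : 0 < η) : Measurable (cutoffFn P η) :=
  (cutoffFn_antitone P η hη).measurable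

/-- The radial integrand of (III.4) is measurable (the cutoff is monotone). [cite: MagnenRivasseauSeneor1993, (II.14) p.331, (III.4) p.351] -/
theorem measurable_radialIntegrand (hη : 0 < η) : Measurable (radialIntegrand P η t) := by
  have hκ := measurable_cutoffFn P hη
  unfold radialIntegrand bracket
  fun_prop

/-- The radial integrand is interval-integrable on every `[a, b]` with `a > 0` (bounded and measurable).
[cite: MagnenRivasseauSeneor1993, (II.14) p.331, (III.4) p.351] -/
theorem radialIntegrand_intervalIntegrable (hη : 0 < η) {a b : ℝ} (ha : 0 < a) (hab : a ≤ b) :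
    IntervalIntegrable (radialIntegrand P η t) volume a b := by
  refine (intervalIntegrable_const (c := absCoeff t / a)).mono_fun'
    (measurable_radialIntegrand P t hη).aestronglyMeasurable ?_
  refine (ae_restrict_mem measurableSet_uIoc).mono fun r hr => ?_
  rw [uIoc_of_le hab] at hr
  simpa [Real.norm_eq_abs] using abs_radialIntegrand_le P t ha hr.1.le

/-- **The one-loop `(A⁴/24)` coefficient of (III.4)–(III.6), radial form**, for the cutoff (II.14): the `dr/r`-integral of the printed
bracket over the support `[1, 3 + η⁻¹]` of the integrand (it vanishes identically outside: `radialIntegrand_of_le_one`,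
`radialIntegrand_of_le`). [cite: MagnenRivasseauSeneor1993, (III.4)–(III.6) pp.351–352] -/
def oneLoopA4Radial (P : CutoffProfile) (η t : ℝ) : ℝ := ∫ r in (1 : ℝ)..(3 + η⁻¹), radialIntegrand P η t r

/-! ## §3 The three shells: transition `[1,2]`, plateau `[2, 2+η⁻¹]`, tail `[2+η⁻¹, 3+η⁻¹]` -/

/-- A shell `[a, b]`, `0 < a ≤ b`, contributes at most `absCoeff(t)·log(b/a)` in absolute value.
[cite: MagnenRivasseauSeneor1993, (III.4)–(III.6) pp.351–352] -/
theorem abs_integral_shell_le {a b : ℝ} (ha : 0 < a) (hab : a ≤ b) :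
    |∫ r in a..b, radialIntegrand P η t r| ≤ absCoeff t * Real.log (b / a) := by
  have hb : 0 < b := lt_of_lt_of_le ha hab
  have h := intervalIntegral.norm_integral_le_of_norm_le (f := radialIntegrand P η t)
    (g := fun r => absCoeff t * (1 / r)) (μ := volume) hab
    (Filter.Eventually.of_forall fun r hr => ?_) ?_
  · rw [Real.norm_eq_abs] at h
    rw [intervalIntegral.integral_const_mul, integral_one_div_of_pos ha hb] at h
    exact h
  · have hr : 0 < r := lt_of_lt_of_le ha hr.1.le
    rw [Real.norm_eq_abs]
    unfold radialIntegrand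
    rw [abs_div, abs_of_pos hr, mul_one_div]
    gcongr
    exact abs_bracket_le t (cutoffFn_nonneg P η r) (cutoffFn_le_one P η r)
  · apply ContinuousOn.intervalIntegrable
    apply ContinuousOn.mul continuousOn_const
    apply ContinuousOn.div continuousOn_const continuousOn_id
    intro r hr
    rw [uIcc_of_le hab] at hr
    exact (lt_of_lt_of_le ha hr.1).ne'

/-- The transition shell `[1, 2]` (first region of (III.5)): `|∫_1^2| ≤ absCoeff(t)·log 2`, uniformly in `η` AND in the profile `τ`
— a «finite term» of (III.6). [cite: MagnenRivasseauSeneor1993, (II.14) p.331, (III.5) p.351, (III.6) p.352] -/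
theorem abs_integral_core_le (η : ℝ) :
    |∫ r in (1 : ℝ)..2, radialIntegrand P η t r| ≤ absCoeff t * Real.log 2 := by
  simpa using abs_integral_shell_le P t (η := η) one_pos one_le_two

/-- The plateau `[2, 2 + η⁻¹]` (third region of (III.5), where the bracket is the printed `[(36 + …)/4 − (90 + …)/8 + (54 + …)/16]`)
contributes EXACTLY `lnEtaCoeff(t)·log((2 + η⁻¹)/2) = 9/8(1 + t/2 + 5t²/12)·(|ln η| + log((1 + 2η)/2))` (the tree's
`OneLoop.plateau_radial_integral` ∕ `log_plateau_eq` mechanism with the full bracket).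
[cite: MagnenRivasseauSeneor1993, (II.14) p.331, (III.5) p.351, (III.6) p.352] -/
theorem integral_plateau_eq (hη : 0 < η) :
    ∫ r in (2 : ℝ)..(2 + η⁻¹), radialIntegrand P η t r = lnEtaCoeff t * Real.log ((2 + η⁻¹) / 2) := by
  have hle : (2 : ℝ) ≤ 2 + η⁻¹ := by linarith [inv_pos.mpr hη]
  have h3 : (0 : ℝ) < 2 + η⁻¹ := by positivity
  have hcongr : ∫ r in (2 : ℝ)..(2 + η⁻¹), radialIntegrand P η t r =
      ∫ r in (2 : ℝ)..(2 + η⁻¹), lnEtaCoeff t * (1 / r) := by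
    rw [intervalIntegral.integral_of_le hle, intervalIntegral.integral_of_le hle]
    refine setIntegral_congr_fun measurableSet_Ioc fun r hr => ?_
    rw [radialIntegrand_plateau P t hr.1 hr.2, mul_one_div]
  rw [hcongr, intervalIntegral.integral_const_mul, integral_one_div_of_pos two_pos h3]

/-- The tail shell `[2 + η⁻¹, 3 + η⁻¹]` (second region of (III.5); `κ = 0` beyond `3 + η⁻¹`): `|∫| ≤ absCoeff(t)·log((3 + η⁻¹)/(2 +
η⁻¹)) ≤ absCoeff(t)·log 2` — the other «finite term» of (III.6), again uniform in `η` and `τ`.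
[cite: MagnenRivasseauSeneor1993, (II.14) p.331, (III.5) p.351, (III.6) p.352] -/
theorem abs_integral_tail_le (hη : 0 < η) :
    |∫ r in (2 + η⁻¹ : ℝ)..(3 + η⁻¹), radialIntegrand P η t r| ≤ absCoeff t * Real.log 2 := by
  have hη' : 0 < η⁻¹ := inv_pos.mpr hη
  have ha : (0 : ℝ) < 2 + η⁻¹ := by positivity
  have h := abs_integral_shell_le P t (η := η) ha (by linarith : (2 : ℝ) + η⁻¹ ≤ 3 + η⁻¹)
  refine h.trans (mul_le_mul_of_nonneg_left ?_ (absCoeff_nonneg t))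
  apply Real.log_le_log (by positivity)
  rw [div_le_iff₀ ha]
  linarith

/-- **(III.5)** p.351 — the three-region decomposition AS PRINTED («∫_{1≤|p|M^{−ρ}<2} … + ∫_{2+η⁻¹<|p|M^{−ρ}≤3+η⁻¹} … +
∫_{2≤|p|M^{−ρ}<2+η⁻¹} (d⁴p/p⁴)[(36 + …)/4 − (90 + …)/8 + (54 + …)/16]»), in radial form: transition shell + plateau + tail shell (the
plateau term is evaluated in `integral_plateau_eq`). [cite: MagnenRivasseauSeneor1993, (III.5) p.351] -/
theorem oneLoopA4Radial_split (hη : 0 < η) :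
    oneLoopA4Radial P η t = (∫ r in (1 : ℝ)..2, radialIntegrand P η t r)
      + (∫ r in (2 : ℝ)..(2 + η⁻¹), radialIntegrand P η t r)
      + (∫ r in (2 + η⁻¹ : ℝ)..(3 + η⁻¹), radialIntegrand P η t r) := by
  have hη' : 0 < η⁻¹ := inv_pos.mpr hη
  have i1 := radialIntegrand_intervalIntegrable P t hη one_pos one_le_two
  have i2 := radialIntegrand_intervalIntegrable P t hη two_pos (by linarith : (2 : ℝ) ≤ 2 + η⁻¹)
  have i3 := radialIntegrand_intervalIntegrable P t hη (by positivity : (0:ℝ) < 2 + η⁻¹)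
    (by linarith : (2 : ℝ) + η⁻¹ ≤ 3 + η⁻¹)
  unfold oneLoopA4Radial
  rw [← integral_add_adjacent_intervals i1 (i2.trans i3), ← integral_add_adjacent_intervals i2 i3]
  ring

/-! ## §4 The «finite terms» of (III.6) are bounded — hence the positivity clause of Lemma III.1 -/

/-- The «finite terms» of (III.6) for the cutoff (II.14): the one-loop coefficient minus its `|ln η|` part.
[cite: MagnenRivasseauSeneor1993, (III.6) p.352] -/
def finiteTerms (P : CutoffProfile) (t η : ℝ) : ℝ := oneLoopA4Radial P η t - lnEtaCoeff t * (-Real.log η)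

/-- The explicit, τ-INDEPENDENT bound on the finite terms. [cite: MagnenRivasseauSeneor1993, (III.6) p.352] -/
def finiteConst (t : ℝ) : ℝ := (lnEtaCoeff t + 2 * absCoeff t) * Real.log 2

/-- **«finite terms … uniformly bounded … as η tends to 0» (p.352 tl.8–9), PROVED for the cutoff (II.14)**: for every profile `τ`,
every gauge (`t = 1/ζ − 1` arbitrary real) and every `0 < η ≤ ½`,
`|a(η) − 9/8(1 + t/2 + 5t²/12)|ln η|| ≤ (lnEtaCoeff t + 2 absCoeff t)·log 2`.
[cite: MagnenRivasseauSeneor1993, Lemma III.1 p.348, (III.6) p.352] -/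
theorem abs_finiteTerms_le (hη : 0 < η) (hη2 : η ≤ 1 / 2) : |finiteTerms P t η| ≤ finiteConst t := by
  have hsplit := oneLoopA4Radial_split P t hη
  have h1 := abs_integral_core_le P t η
  have h2 := integral_plateau_eq P t hη
  have h3 := abs_integral_tail_le P t hη
  have hlog := log_plateau_eq hη
  have hrem := abs_log_plateau_remainder_le hη hη2
  have hcoef : 0 ≤ lnEtaCoeff t := by
    have := half_lt_lnEtaCoeff t
    linarith
  have key : finiteTerms P t η = (∫ r in (1 : ℝ)..2, radialIntegrand P η t r)
      + lnEtaCoeff t * Real.log ((1 + 2 * η) / 2)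
      + (∫ r in (2 + η⁻¹ : ℝ)..(3 + η⁻¹), radialIntegrand P η t r) := by
    unfold finiteTerms
    rw [hsplit, h2, hlog]
    ring
  rw [key]
  calc |(∫ r in (1 : ℝ)..2, radialIntegrand P η t r) + lnEtaCoeff t * Real.log ((1 + 2 * η) / 2)
        + (∫ r in (2 + η⁻¹ : ℝ)..(3 + η⁻¹), radialIntegrand P η t r)|
      ≤ |∫ r in (1 : ℝ)..2, radialIntegrand P η t r| + |lnEtaCoeff t * Real.log ((1 + 2 * η) / 2)|
        + |∫ r in (2 + η⁻¹ : ℝ)..(3 + η⁻¹), radialIntegrand P η t r| := abs_add_three _ _ _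
    _ ≤ absCoeff t * Real.log 2 + lnEtaCoeff t * Real.log 2 + absCoeff t * Real.log 2 := by
        gcongr
        rw [abs_mul, abs_of_nonneg hcoef]
        exact mul_le_mul_of_nonneg_left hrem hcoef
    _ = finiteConst t := by unfold finiteConst; ring

/-- Worked numbers in the Feynman gauge `ζ = 1` (`t = 0`): `absCoeff 0 = 36 + 90 + 54 = 180`, `lnEtaCoeff 0 = 9/8`, so the finite
terms are bounded by `(9/8 + 360)·log 2` and the τ-uniform threshold is `η ≤ min(½, exp(−160·(9/8 + 360)·log 2/73))`.
[cite: MagnenRivasseauSeneor1993, (III.6)–(III.7) p.352] -/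
theorem finiteConst_feynman : absCoeff 0 = 180 ∧ finiteConst 0 = (9 / 8 + 360) * Real.log 2 := by
  have h1 : absCoeff 0 = 180 := by
    unfold absCoeff G1 G2 G3 G4
    norm_num [abs_of_pos, abs_of_neg]
  refine ⟨h1, ?_⟩
  unfold finiteConst
  rw [h1, lnEtaCoeff_eq]
  ring

/-- The one-loop coefficient IS of the shape `oneLoopA4Coeff t F` of file 3 (`MRS93CountertermScaling`) with `F` = the finite terms.
[cite: MagnenRivasseauSeneor1993, (III.6) p.352] -/
theorem oneLoopA4Radial_eq_oneLoopA4Coeff (η : ℝ) :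
    oneLoopA4Radial P η t = oneLoopA4Coeff t (finiteTerms P t) η := by
  unfold oneLoopA4Coeff finiteTerms
  ring

/-- **Lemma III.1, second sentence (p.348 tl.7–8) — DISCHARGED for the printed one-loop integral**: «by choosing the cutoff of the
form (II.14) with η small enough (depending on the shape of τ), the coefficient a is strictly positive» — the AS-PRINTED predicate
`Counterterms.LemmaIII1PositivityPrinted` of `MRS93CountertermScaling` HOLDS for `η ↦ oneLoopA4Radial P η t`, for EVERY profile
`τ` and every real `t = 1/ζ − 1` (threshold `η₀ = min(½, ½, exp(−160·finiteConst(t)/73))`, uniform in `τ`).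
[cite: MagnenRivasseauSeneor1993, Lemma III.1 p.348, (III.4)–(III.7) pp.351–352] -/
theorem lemmaIII1Positivity_oneLoopA4Radial :
    LemmaIII1PositivityPrinted (fun η => oneLoopA4Radial P η t) := by
  have hfun : (fun η => oneLoopA4Radial P η t) = oneLoopA4Coeff t (finiteTerms P t) := by
    funext η
    exact oneLoopA4Radial_eq_oneLoopA4Coeff P t η
  rw [hfun]
  exact positivity_of_boundedFiniteTerms t (C := finiteConst t) (by norm_num : (0:ℝ) < 1 / 2)
    (fun η hη hle => abs_finiteTerms_le P t hη hle)

/-- **(III.7) quantitative**: for `0 < η ≤ min(½, exp(−160·finiteConst(t)/73))` the one-loop coefficient is `≥ ½|ln η|` (`> 0`).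
[cite: MagnenRivasseauSeneor1993, (III.7) p.352] -/
theorem half_abs_log_le_oneLoopA4Radial (hη : 0 < η) (hη2 : η ≤ 1 / 2)
    (hsmall : η ≤ Real.exp (-(160 * finiteConst t / 73))) :
    1 / 2 * (-Real.log η) ≤ oneLoopA4Radial P η t := by
  rw [oneLoopA4Radial_eq_oneLoopA4Coeff]
  exact stabilizing_coefficient_ge_half_log t (abs_finiteTerms_le P t hη hη2) hη hsmall

/-- «the coefficient a is strictly positive» with an EXPLICIT, τ-independent threshold: `0 < oneLoopA4Radial P η t` for every
`0 < η ≤ min(½, exp(−160·finiteConst(t)/73))`. [cite: MagnenRivasseauSeneor1993, Lemma III.1 p.348, (III.7) p.352] -/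
theorem oneLoopA4Radial_pos (hη : 0 < η) (hη2 : η ≤ 1 / 2)
    (hsmall : η ≤ Real.exp (-(160 * finiteConst t / 73))) : 0 < oneLoopA4Radial P η t := by
  have h := half_abs_log_le_oneLoopA4Radial P t hη hη2 hsmall
  have hlog : 0 < -Real.log η := by
    have := Real.log_neg hη (by linarith : η < 1)
    linarith
  linarith

/-- The shape in which Sect. VI USES (III.7) («using the fact that β = κ/v and 0 ≤ κ ≤ 1 and using (III.7)», (VI.35) p.374; typed in
this seat's `MRS93HomotheticLemmaVI2.lemmaVI1Printed_cross_of_representation` as the hypothesis `|Real.log η| ≤ CT₄`): for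
`0 < η ≤ min(½, exp(−160·finiteConst(t)/73))`, `|ln η| ≤ 2·a(η)`. [cite: MagnenRivasseauSeneor1993, (III.7) p.352, (VI.35) p.374] -/
theorem abs_log_le_two_mul_oneLoopA4Radial (hη : 0 < η) (hη2 : η ≤ 1 / 2)
    (hsmall : η ≤ Real.exp (-(160 * finiteConst t / 73))) : |Real.log η| ≤ 2 * oneLoopA4Radial P η t := by
  have h := half_abs_log_le_oneLoopA4Radial P t hη hη2 hsmall
  have hneg : Real.log η < 0 := Real.log_neg hη (by linarith)
  rw [abs_of_neg hneg]
  linarith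

/-- «the coefficient of this stabilizing term can be made as large as we want, if η is small enough» (p.352 tl.16–17): for every
`K ≥ 0`, `oneLoopA4Radial ≥ K` once `0 < η ≤ min(½, exp(−(K + finiteConst t)·160/153))`. [cite: MagnenRivasseauSeneor1993, §III p.352] -/
theorem le_oneLoopA4Radial_of_small (hη : 0 < η) (hη2 : η ≤ 1 / 2) {K : ℝ} (hK : 0 ≤ K)
    (hsmall : η ≤ Real.exp (-((K + finiteConst t) * 160 / 153))) : K ≤ oneLoopA4Radial P η t := by
  rw [oneLoopA4Radial_eq_oneLoopA4Coeff]
  exact oneLoopA4Coeff_large t (abs_finiteTerms_le P t hη hη2) hK hη hsmall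

/-- **(III.6) as an asymptotic statement**: «the one loop (A⁴/24) contribution behaves as 9/8(1 + (1/ζ − 1)/2 + 5/12(1/ζ − 1)²)|ln η|
+ finite terms» — `a(η)/|ln η| → lnEtaCoeff(t)` as `η → 0⁺`, for every profile `τ` and every `t`.
[cite: MagnenRivasseauSeneor1993, (III.6) p.352] -/
theorem tendsto_oneLoopA4Radial_div_log :
    Filter.Tendsto (fun η => oneLoopA4Radial P η t / (-Real.log η)) (nhdsWithin 0 (Ioi 0)) (nhds (lnEtaCoeff t)) := by
  have hlog : Filter.Tendsto (fun η : ℝ => -Real.log η) (nhdsWithin 0 (Ioi 0)) Filter.atTop :=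
    Filter.tendsto_neg_atBot_atTop.comp Real.tendsto_log_nhdsGT_zero
  have hsmall : ∀ᶠ η in nhdsWithin (0 : ℝ) (Ioi 0), 0 < η ∧ η ≤ 1 / 2 := by
    have h1 : ∀ᶠ η in nhdsWithin (0 : ℝ) (Ioi 0), η ∈ Ioi (0 : ℝ) := self_mem_nhdsWithin
    have h2 : ∀ᶠ η in nhdsWithin (0 : ℝ) (Ioi 0), η < 1 / 2 :=
      nhdsWithin_le_nhds (Iio_mem_nhds (by norm_num : (0 : ℝ) < 1 / 2))
    filter_upwards [h1, h2] with η hη hη2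
    exact ⟨hη, hη2.le⟩
  -- the finite terms divided by `|ln η|` tend to `0`
  have hF : Filter.Tendsto (fun η => finiteTerms P t η / (-Real.log η)) (nhdsWithin 0 (Ioi 0)) (nhds 0) := by
    have hbound : Filter.Tendsto (fun η : ℝ => finiteConst t / (-Real.log η)) (nhdsWithin 0 (Ioi 0)) (nhds 0) :=
      tendsto_const_nhds.div_atTop hlog
    refine squeeze_zero_norm' ?_ hbound
    filter_upwards [hsmall] with η hη
    have hpos : 0 < -Real.log η := by
      have := Real.log_neg hη.1 (by linarith [hη.2] : η < 1)
      linarith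
    rw [Real.norm_eq_abs, abs_div, abs_of_pos hpos]
    exact div_le_div_of_nonneg_right (abs_finiteTerms_le P t hη.1 hη.2) hpos.le
  have heq : (fun η => oneLoopA4Radial P η t / (-Real.log η)) =ᶠ[nhdsWithin 0 (Ioi 0)]
      fun η => lnEtaCoeff t + finiteTerms P t η / (-Real.log η) := by
    filter_upwards [hsmall] with η hη
    have hpos : 0 < -Real.log η := by
      have := Real.log_neg hη.1 (by linarith [hη.2] : η < 1)
      linarith
    have hne : Real.log η ≠ 0 := (by linarith : Real.log η < 0).ne
    unfold finiteTerms
    field_simp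
    ring
  rw [Filter.tendsto_congr' heq]
  simpa using tendsto_const_nhds.add hF

/-! ## §5 `d = 4`: the printed `∫ d⁴p/p⁴ […]` and its independence of the cutoff index `ρ` -/

/-- **The one-loop `(A⁴/24)` integral (III.4) AS PRINTED**, «∫ (d⁴p/p⁴)[(36 + …)κ² − (90 + …)κ³ + (54 + …)κ⁴]», for the cutoff
`κ(p) = cutoffFn P η |p|` of (II.14) on `ℝ⁴`. [cite: MagnenRivasseauSeneor1993, (III.4) p.351] -/
def oneLoopA4Integral (P : CutoffProfile) (η t : ℝ) : ℝ :=
  ∫ p : EuclideanSpace ℝ (Fin 4), bracket t (cutoffFn P η ‖p‖) / ‖p‖ ^ 4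

/-- `|S³| = 2π²`: `dim ℝ⁴ · vol(B⁴) = 4 · π²/2`. [folklore] -/
private theorem volume_real_ball_four' :
    (volume : Measure (EuclideanSpace ℝ (Fin 4))).real (ball 0 1) = π ^ 2 / 2 := by
  have hdim : Module.finrank ℝ (EuclideanSpace ℝ (Fin 4)) = 2 * 2 := by
    rw [finrank_euclideanSpace_fin]
  rw [measureReal_def, InnerProductSpace.volume_ball_of_dim_even hdim, hdim]
  simp only [ENNReal.ofReal_one, one_pow, one_mul, Nat.factorial_two, Nat.cast_ofNat]
  rw [ENNReal.toReal_ofReal (by positivity)]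

/-- **Polar coordinates: `∫ d⁴p/p⁴ bracket(κ(p)) = 2π² · ∫_1^{3+η⁻¹} bracket(κ(r)) dr/r`** (`d⁴p = |S³| r³ dr`, and the integrand
vanishes off `1 ≤ |p| ≤ 3 + η⁻¹`). [cite: MagnenRivasseauSeneor1993, (III.4)–(III.6) pp.351–352] -/
theorem oneLoopA4Integral_eq (hη : 0 < η) : oneLoopA4Integral P η t = 2 * π ^ 2 * oneLoopA4Radial P η t := by
  have hη' : 0 < η⁻¹ := inv_pos.mpr hη
  have h13 : (1 : ℝ) ≤ 3 + η⁻¹ := by linarith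
  unfold oneLoopA4Integral
  rw [integral_fun_norm_addHaar volume (fun r => bracket t (cutoffFn P η r) / r ^ 4), volume_real_ball_four',
    finrank_euclideanSpace_fin]
  have hI : ∫ y in Ioi (0 : ℝ), y ^ (4 - 1) • (bracket t (cutoffFn P η y) / y ^ 4) = oneLoopA4Radial P η t := by
    have heq : (fun y : ℝ => y ^ (4 - 1) • (bracket t (cutoffFn P η y) / y ^ 4)) =ᵐ[volume.restrict (Ioi (0:ℝ))]
        (Icc 1 (3 + η⁻¹)).indicator (radialIntegrand P η t) := by
      refine (ae_restrict_mem measurableSet_Ioi).mono fun y hy => ?_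
      have hy0 : (0 : ℝ) < y := hy
      have h41 : (4 - 1 : ℕ) = 3 := rfl
      have hval : y ^ (4 - 1) • (bracket t (cutoffFn P η y) / y ^ 4) = radialIntegrand P η t y := by
        rw [h41, smul_eq_mul, radialIntegrand]
        field_simp
      show y ^ (4 - 1) • (bracket t (cutoffFn P η y) / y ^ 4) = (Icc 1 (3 + η⁻¹)).indicator (radialIntegrand P η t) y
      rw [hval]
      by_cases hmem : y ∈ Icc (1 : ℝ) (3 + η⁻¹)
      · rw [indicator_of_mem hmem]
      · rw [indicator_of_notMem hmem]
        rw [mem_Icc, not_and_or, not_le, not_le] at hmem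
        rcases hmem with h | h
        · exact radialIntegrand_of_le_one P t h.le
        · exact radialIntegrand_of_le P t hη h.le
    rw [integral_congr_ae heq, MeasureTheory.integral_indicator measurableSet_Icc, Measure.restrict_restrict measurableSet_Icc,
      show Icc (1 : ℝ) (3 + η⁻¹) ∩ Ioi 0 = Icc 1 (3 + η⁻¹) from
        inter_eq_left.mpr (fun y hy => lt_of_lt_of_le one_pos hy.1),
      integral_Icc_eq_integral_Ioc, ← intervalIntegral.integral_of_le h13]
    rfl
  rw [hI]
  simp only [nsmul_eq_mul, smul_eq_mul, Nat.cast_ofNat]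
  ring

/-- The integral of (III.4) restricted to a spherical shell `a < |p| ≤ b` — the region integrals of (III.5).
[cite: MagnenRivasseauSeneor1993, (III.5) p.351] -/
def regionIntegral (P : CutoffProfile) (η t a b : ℝ) : ℝ :=
  ∫ p : EuclideanSpace ℝ (Fin 4), (Ioc a b).indicator (fun r => bracket t (cutoffFn P η r) / r ^ 4) ‖p‖

/-- Polar coordinates on a shell: `∫_{a<|p|≤b} d⁴p/p⁴ bracket(κ(p)) = 2π²·∫_a^b bracket(κ(r)) dr/r` (`0 < a ≤ b`).
[cite: MagnenRivasseauSeneor1993, (III.5) p.351] -/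
theorem regionIntegral_eq {a b : ℝ} (ha : 0 < a) (hab : a ≤ b) :
    regionIntegral P η t a b = 2 * π ^ 2 * ∫ r in a..b, radialIntegrand P η t r := by
  unfold regionIntegral
  rw [integral_fun_norm_addHaar volume (fun r => (Ioc a b).indicator (fun r => bracket t (cutoffFn P η r) / r ^ 4) r),
    volume_real_ball_four', finrank_euclideanSpace_fin]
  have hI : ∫ y in Ioi (0 : ℝ), y ^ (4 - 1) • (Ioc a b).indicator (fun r => bracket t (cutoffFn P η r) / r ^ 4) y =
      ∫ r in a..b, radialIntegrand P η t r := by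
    have heq : (fun y : ℝ => y ^ (4 - 1) • (Ioc a b).indicator (fun r => bracket t (cutoffFn P η r) / r ^ 4) y)
        =ᵐ[volume.restrict (Ioi (0:ℝ))] (Ioc a b).indicator (radialIntegrand P η t) := by
      refine (ae_restrict_mem measurableSet_Ioi).mono fun y hy => ?_
      have hy0 : (0 : ℝ) < y := hy
      have h41 : (4 - 1 : ℕ) = 3 := rfl
      show y ^ (4 - 1) • (Ioc a b).indicator (fun r => bracket t (cutoffFn P η r) / r ^ 4) y =
        (Ioc a b).indicator (radialIntegrand P η t) y
      by_cases hmem : y ∈ Ioc a b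
      · rw [indicator_of_mem hmem, indicator_of_mem hmem, h41, smul_eq_mul, radialIntegrand]
        field_simp
      · rw [indicator_of_notMem hmem, indicator_of_notMem hmem, smul_zero]
    rw [integral_congr_ae heq, MeasureTheory.integral_indicator measurableSet_Ioc, Measure.restrict_restrict measurableSet_Ioc,
      show Ioc a b ∩ Ioi 0 = Ioc a b from inter_eq_left.mpr (fun y hy => lt_trans ha hy.1),
      ← intervalIntegral.integral_of_le hab]
  rw [hI]
  simp only [nsmul_eq_mul, smul_eq_mul, Nat.cast_ofNat]
  ring

/-- **(III.5) in `d = 4`, AS PRINTED**: «∫_{1≤|p|M^{−ρ}<2} (d⁴p/p⁴)[…] + ∫_{2+η⁻¹<|p|M^{−ρ}≤3+η⁻¹} (d⁴p/p⁴)[…] + ∫_{2≤|p|M^{−ρ}<2+η⁻¹}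
(d⁴p/p⁴)[(36 + …)/4 − (90 + …)/8 + (54 + …)/16]» — the one-loop integral is the sum of the three region integrals, in the printed
order (after the scaling `p ↦ pM^ρ`, `oneLoopA4Integral_scaledCutoff`; shell boundaries are Lebesgue-null, reading (v)).
[cite: MagnenRivasseauSeneor1993, (III.5) p.351] -/
theorem displayIII5 (hη : 0 < η) :
    oneLoopA4Integral P η t = regionIntegral P η t 1 2 + regionIntegral P η t (2 + η⁻¹) (3 + η⁻¹)
      + regionIntegral P η t 2 (2 + η⁻¹) := by
  have hη' : 0 < η⁻¹ := inv_pos.mpr hη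
  rw [oneLoopA4Integral_eq P t hη, oneLoopA4Radial_split P t hη, regionIntegral_eq P t one_pos one_le_two,
    regionIntegral_eq P t (by positivity : (0:ℝ) < 2 + η⁻¹) (by linarith : (2 : ℝ) + η⁻¹ ≤ 3 + η⁻¹),
    regionIntegral_eq P t two_pos (by linarith : (2 : ℝ) ≤ 2 + η⁻¹)]
  ring

/-- The plateau region of (III.5) evaluated: `∫_{2<|p|≤2+η⁻¹} (d⁴p/p⁴)[…/4 − …/8 + …/16] = 2π²·9/8(1 + t/2 + 5t²/12)·log((2 + η⁻¹)/2)`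
(the `|ln η|` of (III.6) with its normalisation `|S³| = 2π²`; equals the tree's `OneLoop.one_loop_A4_shell_eq` value).
[cite: MagnenRivasseauSeneor1993, (III.5) p.351, (III.6) p.352] -/
theorem regionIntegral_plateau_eq (hη : 0 < η) :
    regionIntegral P η t 2 (2 + η⁻¹) = 2 * π ^ 2 * (9 / 8 * (1 + t / 2 + 5 / 12 * t ^ 2)) * Real.log ((2 + η⁻¹) / 2) := by
  have hη' : 0 < η⁻¹ := inv_pos.mpr hη
  rw [regionIntegral_eq P t two_pos (by linarith : (2 : ℝ) ≤ 2 + η⁻¹), integral_plateau_eq P t hη, ← lnEtaCoeff_eq]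
  ring

/-- The two transition regions of (III.5) are the «finite terms»: each is at most `2π²·absCoeff(t)·log 2` in absolute value, uniformly
in `η ∈ (0, ∞)` and in the profile `τ`. [cite: MagnenRivasseauSeneor1993, (III.5) p.351, (III.6) p.352] -/
theorem abs_regionIntegral_transition_le (hη : 0 < η) :
    |regionIntegral P η t 1 2| ≤ 2 * π ^ 2 * (absCoeff t * Real.log 2) ∧
      |regionIntegral P η t (2 + η⁻¹) (3 + η⁻¹)| ≤ 2 * π ^ 2 * (absCoeff t * Real.log 2) := by
  have hη' : 0 < η⁻¹ := inv_pos.mpr hη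
  have h2pi : (0 : ℝ) ≤ 2 * π ^ 2 := by positivity
  refine ⟨?_, ?_⟩
  · rw [regionIntegral_eq P t one_pos one_le_two, abs_mul, abs_of_nonneg h2pi]
    exact mul_le_mul_of_nonneg_left (abs_integral_core_le P t η) h2pi
  · rw [regionIntegral_eq P t (by positivity : (0:ℝ) < 2 + η⁻¹) (by linarith : (2 : ℝ) + η⁻¹ ≤ 3 + η⁻¹), abs_mul,
      abs_of_nonneg h2pi]
    exact mul_le_mul_of_nonneg_left (abs_integral_tail_le P t hη) h2pi

/-- **Lemma III.1's positivity clause for the printed `d = 4` integral.** [cite: MagnenRivasseauSeneor1993, Lemma III.1 p.348, (III.4)–(III.7)] -/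
theorem lemmaIII1Positivity_oneLoopA4Integral :
    LemmaIII1PositivityPrinted (fun η => oneLoopA4Integral P η t) := by
  obtain ⟨η₀, hη₀, h⟩ := lemmaIII1Positivity_oneLoopA4Radial P t
  refine ⟨η₀, hη₀, fun η hη hle => ?_⟩
  have hrad : 0 < oneLoopA4Radial P η t := h η hη hle
  show 0 < oneLoopA4Integral P η t
  rw [oneLoopA4Integral_eq P t hη]
  positivity

/-- **Independence of the cutoff index `ρ`** («for a single cutoff κ_ρ(p) = κ(pM^{−ρ}) (all our integrals are infrared regularized and
"finite" means finite as ρ → ∞)», p.351 tl.17–19): replacing `κ(|p|)` by `κ(c|p|)` for ANY `c > 0` (e.g. `c = M^{−ρ}`) leaves the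
`d⁴p/p⁴`-integral unchanged — the measure `d⁴p/p⁴` is scale invariant. [cite: MagnenRivasseauSeneor1993, (II.13) p.331, (III.4) p.351] -/
theorem oneLoopA4Integral_scale {c : ℝ} (hc : 0 < c) :
    ∫ p : EuclideanSpace ℝ (Fin 4), bracket t (cutoffFn P η (c * ‖p‖)) / ‖p‖ ^ 4 = oneLoopA4Integral P η t := by
  have key : (fun p : EuclideanSpace ℝ (Fin 4) => bracket t (cutoffFn P η (c * ‖p‖)) / ‖p‖ ^ 4) =
      fun p => c ^ 4 * ((fun q : EuclideanSpace ℝ (Fin 4) => bracket t (cutoffFn P η ‖q‖) / ‖q‖ ^ 4) (c • p)) := by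
    funext p
    simp only [norm_smul, Real.norm_eq_abs, abs_of_pos hc]
    rw [mul_pow]
    field_simp
  rw [key, MeasureTheory.integral_const_mul, Measure.integral_comp_smul volume
    (fun q : EuclideanSpace ℝ (Fin 4) => bracket t (cutoffFn P η ‖q‖) / ‖q‖ ^ 4) c,
    finrank_euclideanSpace_fin, smul_eq_mul, oneLoopA4Integral]
  have hc4 : |(c ^ 4)⁻¹| = (c ^ 4)⁻¹ := abs_of_pos (by positivity)
  rw [hc4]
  field_simp

/-- The same in terms of mrs-lit-1's scaled cutoff (II.13) `Ansatz.scaledCutoff P η M ρ r = κ(r·M^{−ρ})`, for every `M > 0` and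
every `ρ`. [cite: MagnenRivasseauSeneor1993, (II.13) p.331, (III.4) p.351] -/
theorem oneLoopA4Integral_scaledCutoff {M : ℝ} (hM : 0 < M) (ρ : ℕ) :
    ∫ p : EuclideanSpace ℝ (Fin 4), bracket t (scaledCutoff P η M ρ ‖p‖) / ‖p‖ ^ 4 = oneLoopA4Integral P η t := by
  have h : ∀ p : EuclideanSpace ℝ (Fin 4), scaledCutoff P η M ρ ‖p‖ = cutoffFn P η (M ^ (-(ρ:ℤ)) * ‖p‖) := by
    intro p
    rw [scaledCutoff, mul_comm]
  simp_rw [h]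
  exact oneLoopA4Integral_scale P t (zpow_pos hM _)

/-- Hence the positivity clause holds for the one-loop integral written with the scaled cutoff `κ_ρ` of (II.13), for EVERY cutoff
index `ρ` (and every `M > 0`, profile `τ`, gauge `t`), with the same threshold — the printed «finite as ρ → ∞» is here exact
ρ-independence. [cite: MagnenRivasseauSeneor1993, Lemma III.1 p.348, (II.13) p.331, (III.4) p.351] -/
theorem lemmaIII1Positivity_scaledCutoff {M : ℝ} (hM : 0 < M) (ρ : ℕ) :
    LemmaIII1PositivityPrinted
      (fun η => ∫ p : EuclideanSpace ℝ (Fin 4), bracket t (scaledCutoff P η M ρ ‖p‖) / ‖p‖ ^ 4) := by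
  have h : (fun η => ∫ p : EuclideanSpace ℝ (Fin 4), bracket t (scaledCutoff P η M ρ ‖p‖) / ‖p‖ ^ 4) =
      fun η => oneLoopA4Integral P η t := by
    funext η
    exact oneLoopA4Integral_scaledCutoff P t hM ρ
  rw [h]
  exact lemmaIII1Positivity_oneLoopA4Integral P t

/-! ## §6 (EDITION v1.1) Sect. VI consumes (III.7): Lemma VI.1 (VI.5) from the representation (VI.14) ALONE, for the cross-ordered
homothetic integrand, when its quartic-counterterm term is the one-loop integral of this file

p.374 [PDF 50] tl.17–27 (image `renders-cmp155/p50_VI35_s2.png`): «We can then complete the proof of Lemma VI.1. Indeed we write (using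
the fact that β = κ/v and 0 ≤ κ ≤ 1 and using (III.7)): g_k(x) ≤ exp(|Δ|(x⁴[∫_{v<K₁} K₂βv dv − [∫v dv(β²/24)[(36 + 18(1/ζ − 1) + 7.5(1/ζ
− 1)²) − κ(90 + …) + κ²(54 + …)](1 + t²)²]])) ≤ exp(|Δ|x⁴[K₁K₂ − |log η|]) ≤ 1 (VI.35) if, again, we choose the parameter η in Sect. III
sufficiently small so that |log η| ≥ K₁K₂.» The third bracket of (VI.14) is, per unit `|Δ|x⁴` and with `β = κ/v`, a positive multiple
`N` of the radial one-loop coefficient `∫ bracket(κ) dr/r` of §2 (the `β²/24`-bracket is Sect. III's `G₁ + G₂κ + (G₃ + G₄)κ²` times `κ²`,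
as this seat's `MRS93LemmaVI2FeynmanGauge` records for (VI.14) vs Sect. III; the value of `N` — a matter of the conventions `u du` vs
`dr/r`, `(1 + t²)²/24`, `|S³|` — is NOT asserted here: it enters as an explicit positive parameter). This seat's file 21
`MRS93HomotheticLemmaVI2` PROVED (VI.35) ⟹ (VI.5) with Lemma VI.2 discharged and exactly two NAMED inputs: the representation (VI.14)
(`hrep`) and «(III.7)» in the form `|log η| ≤ CT₄`. Below, the SECOND input is DISCHARGED whenever `CT₄ = N·a(η)` for some `N > 0`:
since `a(η) ≥ K` for any `K` once `η` is small (§4 `le_oneLoopA4Radial_of_small`, «as large as we want»), `CT₄ ≥ K₁K₂` directly — the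
printed detour through `|log η|` is not even needed, so NO condition on the normalisation `N` arises. Of Sect. VI's printed chain for the
cross ordering, ONLY (VI.14) then remains a named input. -/

open CrossLemmaVI2 in
/-- **Lemma VI.1 (VI.5) — file 2's `Stability.LemmaVI1Printed D` — for every dressing-factor datum `D` admitting the representation
(VI.14) with the CROSS-ordered homothetic integrand at a gauge `0 < ζ ≤ 1`, whose quartic-counterterm term (per unit `|Δ|x⁴`) is
`N · oneLoopA4Radial P η (1/ζ − 1)` for some fixed `N > 0` and profile `P`** (the one-loop A⁴ coefficient of (III.4) for the cutoff
(II.14) at the same gauge, §2): then `∃ η₀ > 0, ∀ η ∈ (0, η₀], ∀ i α x y, g ≤ 1`. Compared with file 21's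
`lemmaVI1Printed_cross_of_representation`, the hypothesis «(III.7): |log η| ≤ CT₄» is GONE — replaced by this file's theorems on the
printed integral; the threshold is `η₀ = min(η₁/2, ½, exp(−(K₁K₂/N + finiteConst(1/ζ−1))·160/153))` with Lemma VI.2's uniform constants
`K₁, K₂` of file 21. NOT claimed: that MRS's `g_{i,α,Δ}` admits `hrep` ((VI.14) is a functional-determinant identity, not formalised),
nor the value of `N` for the printed conventions; cross ordering only (for the literal ordering of (VI.9) file 17 records `det BF < 0`).
[cite: MagnenRivasseauSeneor1993, §VI Lemma VI.1 (VI.5) p.369, (VI.14) p.372, (VI.35) p.374; §III (III.7) p.352] -/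
theorem lemmaVI1Printed_cross_of_representation_oneLoopCT (D : Stability.DressingFactor) {ζ : ℝ} (hζ0 : 0 < ζ) (hζ1 : ζ ≤ 1)
    {N : ℝ} (hN : 0 < N) {η₁ : ℝ} (hη₁ : 0 < η₁)
    (hrep : ∀ η : ℝ, 0 < η → η < η₁ → ∀ (i α : ℕ) (x y : ℝ),
      ∃ (t vol X : ℝ) (κ : ℝ → ℝ), 0 ≤ t ∧ t ≤ 1 ∧ 0 ≤ vol ∧ (∀ v, 0 ≤ κ v ∧ κ v ≤ 1) ∧
        IntegrableOn (fun v => v * crossFReg (κ v / v) (κ v) t ζ) (Ioi 0) ∧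
        Real.log (D.g η i α x y) =
          vol * X ^ 4 * ((∫ v in Ioi 0, v * crossFReg (κ v / v) (κ v) t ζ) - N * oneLoopA4Radial P η (1 / ζ - 1)) ∧
        0 < D.g η i α x y) :
    Stability.LemmaVI1Printed D := by
  obtain ⟨K₁, K₂, hK₁, hK₂, h⟩ := dressingFactor_le_one_crossReg_uniform hζ0 hζ1
  set tG : ℝ := 1 / ζ - 1 with htG
  set K : ℝ := K₁ * K₂ / N with hKdef
  have hK0 : 0 ≤ K := by positivity
  set η₀ : ℝ := min (min (η₁ / 2) (1 / 2)) (Real.exp (-((K + finiteConst tG) * 160 / 153))) with hη₀def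
  have hη₀pos : 0 < η₀ := lt_min (lt_min (by positivity) (by norm_num)) (Real.exp_pos _)
  refine Stability.lemmaVI1_of_pointwise D hη₀pos ?_
  intro η hη hηle i α x y
  have hηη₁ : η < η₁ := lt_of_le_of_lt (hηle.trans ((min_le_left _ _).trans (min_le_left _ _))) (by linarith)
  have hη2 : η ≤ 1 / 2 := hηle.trans ((min_le_left _ _).trans (min_le_right _ _))
  have hηexp : η ≤ Real.exp (-((K + finiteConst tG) * 160 / 153)) := hηle.trans (min_le_right _ _)
  obtain ⟨t, vol, X, κ, ht0, ht1, hvol, hκ, hint, hrepr, hg⟩ := hrep η hη hηη₁ i α x y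
  -- the counterterm term dominates `K₁K₂`: `a(η) ≥ K₁K₂/N`
  have ha : K ≤ oneLoopA4Radial P η tG := le_oneLoopA4Radial_of_small P tG hη hη2 hK0 hηexp
  set CT₄ : ℝ := N * oneLoopA4Radial P η tG with hCT₄def
  have hCT : K₁ * K₂ ≤ CT₄ := by
    have : N * K ≤ N * oneLoopA4Radial P η tG := mul_le_mul_of_nonneg_left ha hN.le
    have hNK : N * K = K₁ * K₂ := by rw [hKdef]; field_simp
    linarith
  have hCT0 : 0 ≤ CT₄ := le_trans (by positivity) hCT
  -- file 21's (VI.35) with the auxiliary «η′ = e^{−CT₄}» (its `η` enters only through `|log η′| ≤ CT₄` and `K₁K₂ ≤ |log η′|`)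
  have habs : |Real.log (Real.exp (-CT₄))| = CT₄ := by
    rw [Real.log_exp, abs_neg, abs_of_nonneg hCT0]
  exact h ht0 ht1 hvol hκ hint hrepr hg (le_of_eq habs) (by rw [habs]; exact hCT)

open CrossLemmaVI2 in
/-- The instance `ζ = 3/13` (the homothetic gauge of the construction, p.332): Lemma VI.1 from (VI.14) alone, with the one-loop quartic
counterterm at `t = 1/ζ − 1 = 10/3`. [cite: MagnenRivasseauSeneor1993, §VI Lemma VI.1 (VI.5) p.369, (VI.35) p.374; §II p.332] -/
theorem lemmaVI1Printed_cross_homothetic_of_representation_oneLoopCT (D : Stability.DressingFactor) {N : ℝ} (hN : 0 < N)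
    {η₁ : ℝ} (hη₁ : 0 < η₁)
    (hrep : ∀ η : ℝ, 0 < η → η < η₁ → ∀ (i α : ℕ) (x y : ℝ),
      ∃ (t vol X : ℝ) (κ : ℝ → ℝ), 0 ≤ t ∧ t ≤ 1 ∧ 0 ≤ vol ∧ (∀ v, 0 ≤ κ v ∧ κ v ≤ 1) ∧
        IntegrableOn (fun v => v * crossFReg (κ v / v) (κ v) t (3 / 13)) (Ioi 0) ∧
        Real.log (D.g η i α x y) =
          vol * X ^ 4 * ((∫ v in Ioi 0, v * crossFReg (κ v / v) (κ v) t (3 / 13)) - N * oneLoopA4Radial P η (1 / (3 / 13) - 1)) ∧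
        0 < D.g η i α x y) :
    Stability.LemmaVI1Printed D :=
  lemmaVI1Printed_cross_of_representation_oneLoopCT P D (by norm_num) (by norm_num) hN hη₁ hrep

end OneLoopFiniteTerms

end Literature.MathematicalPhysics.QuantumFieldTheory.MagnenRivasseauSeneor1993
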